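import Literature.AlgebraicGeometry.Motives.JacobianGaloisCoverNormAdjointOfThreeLeaves
import Literature.AlgebraicGeometry.Motives.JacobianStepOneMultiplicity
import Literature.AlgebraicGeometry.Motives.JacobianStepOneOpenTransport
import Literature.AlgebraicGeometry.Motives.JacobianThetaDivisorSubscheme
import Literature.AlgebraicGeometry.Motives.AbelTheorem
import HarnessLib

/-!
# `p^*` IS THE WEIL-PAIRING ADJOINT OF `Nm_p` FOR A GALOIS COVER OF CURVES — the named fact
# `Jacobian.galoisCover_pullback_isWeilPairingAdjoint_norm` (interface row VI-8) PROVED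

Layer `Literature/AlgebraicGeometry/Motives`, namespace `Literature.AlgebraicGeometry.Motives.Jacobian`.  ONE THEOREM; no definition, no
named fact, no instance, no `sorry`.  Cell `hodgecm-mathlib` (D-0151), road G4 (pen A-p04 (g17)/(g18); director ruling s225 (4)): the Prop-valued
named fact `galoisCover_pullback_isWeilPairingAdjoint_norm` of `Motives/JacobianGaloisCoverNormAdjoint` — for a Galois cover
`p : X → Y = X/Δ` of smooth projective complex curves with Jacobians `𝒥X`, `𝒥Y` (`dim J_Y ≥ 1`) carrying principal Riemann theta divisors
`Θ_X`, `Θ_Y`, and `t : J_Y → J_X` pinned by `Nm_p ≫ t = Σ_δ δ_*` (= `p^*`), one has `ē_N^{Θ_X}(t P, Q) = ē_N^{Θ_Y}(P, Nm_p Q)` on `N`-torsion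
([LangeRodriguez2022] Prop. 3.5.1 with eq. (3.3); [Lange2023AbelianVarietiesComplex] (4.9); [BirkenhakeLange2004] Lemma 12.3.1) — is
INHABITED, by applying the assembled G4 road ★ `galoisCover_pullback_isWeilPairingAdjoint_norm_of_three_leaves`
(`Motives/JacobianGaloisCoverNormAdjointOfThreeLeaves`: GLUE II ∘ GLUE I ∘ Lange's Lemma 4.4.4 Step I / Milne JV Lemma 6.7 in Abel–Jacobi
currency, ramification and naturality of Abel–Jacobi sums under the cover, degree zero of `f^♮(t_y^*Θ − Θ)`, Cor. 4.4.5 from Step I on a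
dense open) to its three leaves, now all theorems of the tree:

* (ABEL) ★ `Jacobian.ajSum_congr_linEquiv` (`Motives/AbelTheorem`, Lang's specialisation proof of Abel's theorem, model-free): the
  Abel–Jacobi sum `aj_c` is constant on linear equivalence classes;
* (OPEN+TUPLE) ★ `Jacobian.exists_opens_general_abelSum_of_isSmoothProjective` (`Motives/JacobianStepOneOpenTransport`): on a dense open
  of `J` every point is the Abel sum of ONE injective `g`-tuple up to order (Weil's model + `Σ_g : C^g → J` surjective by dimension count);
* (MULT) ★ `Jacobian.exists_open_ordAt_pullbackAvoiding_shear_le_one` (`Motives/JacobianStepOneMultiplicity`, road (E)): for `a` in a dense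
  open the honest pull-back `ι_a^*Θ₀` of an effective `Θ₀` with support `W̃_{g−1}(c)` and INTEGRAL `Z(Θ₀)` has all multiplicities `≤ 1`
  (Milne's incidence `C × Z(Θ₀) → J` is generically étale in characteristic `0`); integrality of `Z(Θ₀)` for a principal polarisation
  divisor with that support is ★ `Jacobian.isIntegral_subscheme_of_support_eq_brillNoetherLocus` (`Motives/JacobianThetaDivisorSubscheme`).

With this file the interface row VI-8 of the cell's inventory is a THEOREM (books: director s225 (4)); its registered consumer
`Summit.HodgeConjecture.CorCM.Lines.A3Liu418.socketRosH_GS_of_FR_FP2` takes it BY NAME.  HC_CM is proved only modulo the 7 printed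
citations until rung 0 closes.

## References
* [LangeRodriguez2022] H. Lange, R. E. Rodríguez, *Decomposition of Jacobians by Prym Varieties*, LNM 2310 (2022), §3.2.1 eq. (3.3) and
  Prop. 3.2.1 (a) (pp. 46–47), §3.5.1 Prop. 3.5.1 (p. 65).
* [Lange2023AbelianVarietiesComplex] H. Lange, *Abelian Varieties over the Complex Numbers* (2023), §4.4.2 Lemma 4.4.4 and Cor. 4.4.5
  (p. 224), §4.5.2 eq. (4.9), §5.3.2 Lemma 5.3.7 (p. 277).
* [BirkenhakeLange2004] C. Birkenhake, H. Lange, *Complex Abelian Varieties*, 2nd ed. (2004), §12.3 Lemma 12.3.1 (p. 372), §11.4 eq. (2) (p. 331).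
* [Milne1986JacobianVarieties] J. S. Milne, *Jacobian Varieties* (1986), §6 Thm. 6.6, Lemma 6.7 (p. 187) and Prop. 6.9.
-/

set_option autoImplicit false

noncomputable section

open CategoryTheory AlgebraicGeometry

namespace Literature.AlgebraicGeometry.Motives

namespace Jacobian

/-- **`p^*` is the Weil-pairing adjoint of `Nm_p` for the canonical principal polarisations of a Galois cover of smooth projective complex
curves** — the named fact `Jacobian.galoisCover_pullback_isWeilPairingAdjoint_norm` (row VI-8) holds: `ē_N^{Θ_X}(t P, Q) = ē_N^{Θ_Y}(P, Nm_p Q)`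
for `Nm_p ≫ t = Σ_δ δ_*`, all `N`, all `N`-torsion `P`, `Q`.  Proof: the three-leaves assembly ★
`galoisCover_pullback_isWeilPairingAdjoint_norm_of_three_leaves` fed with Abel's theorem, the general-Abel-sum open set, and road (E)'s
multiplicity-one statement (module docstring).
[cite: LangeRodriguez2022, §3.2.1 eq. (3.3) and Prop. 3.2.1 (a) (pp. 46–47); §3.5.1 Prop. 3.5.1 (p. 65)]
[cite: Lange2023AbelianVarietiesComplex, §4.4.2 Lemma 4.4.4 and Cor. 4.4.5; §4.5.2 eq. (4.9) and §5.3.2 Lemma 5.3.7 (p. 277)]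
[cite: BirkenhakeLange2004, §12.3 Lemma 12.3.1 (p. 372) and §11.4 eq. (2) (p. 331)]
[cite: Milne1986JacobianVarieties, §6 Thm. 6.6, Lemma 6.7 (p. 187) and Prop. 6.9] -/
theorem galoisCover_pullback_isWeilPairingAdjoint_norm_holds : galoisCover_pullback_isWeilPairingAdjoint_norm :=
  galoisCover_pullback_isWeilPairingAdjoint_norm_of_three_leaves
    (fun 𝒥 hC c _ _ h => by
      haveI : SmoothOfRelativeDimension 1 _ := hC.smoothOfRelativeDimension
      haveI := IsSmoothProjective.isProper_holds hC
      exact 𝒥.ajSum_congr_linEquiv c h)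
    (fun 𝒥 hC hdim c => 𝒥.exists_opens_general_abelSum_of_isSmoothProjective hC hdim c)
    (fun 𝒥 hC hdim c _ h0 hsupp hpr => by
      haveI : SmoothOfRelativeDimension 1 _ := hC.smoothOfRelativeDimension
      haveI := IsSmoothProjective.isProper_holds hC
      exact 𝒥.exists_open_ordAt_pullbackAvoiding_shear_le_one c (𝒥.J.dim - 1) h0 hsupp
        (isIntegral_subscheme_of_support_eq_brillNoetherLocus hC hdim c h0 hsupp hpr)
        (𝒥.exists_opens_general_abelSum_of_isSmoothProjective hC hdim c))

end Jacobian

end Literature.AlgebraicGeometry.Motives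

end
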